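import Mathlib.Algebra.Polynomial.Eval.Degree
import Mathlib.Order.Filter.AtTopBot.Basic
import Literature.Computability.Complexity.GraphComplexity
import Literature.Computability.Complexity.CircuitComposition
import Literature.Computability.Complexity.CircuitSizeProofs
import Literature.Computability.Complexity.Nondeterministic
import HarnessLib

/-!
# Graph complexity II: transference from Boolean circuits (Pudlák–Rödl–Savický, Cavalar–Oliveira)

The classical **double-rail simulation** of a Boolean circuit by set operations: if a ground set `U`
carries an input assignment `pt p ∈ {0,1}^ι` at every point and both *rails* `{p ∈ U | pt p i = b}`
of every input variable are unions of generators, then every `B₂`-gate costs at most `4`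
intersections (its output rails are unions of the four cells of its two input double rails), so
the set of points accepted by a circuit of size `s` has intersection complexity `≤ 4s`
(`interDerivable_filter_eval`; Cavalar–Oliveira 2025, Lemmas 12–13 and Remark 14, where the
constant is stated as `O(1)`; Pudlák–Rödl–Savický 1988, §2).

Specialised to the star generators of `{0,1}ⁿ × {0,1}ⁿ` and the slice graphs `bipSlice L n` of a
language (`starCplx_bipSlice_le_size`, `starCplx_bipSlice_le_circuitSize`): the rails of a left
input bit are unions of row stars, those of a right input bit unions of column stars. Consequence
(the **magnification** phenomenon of graph complexity, Pudlák–Rödl–Savický 1988, §1; Jukna 2012,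
§1.7.1; Cavalar–Oliveira 2025, §1.2): `L ∈ P/poly` forces polynomial-in-`n` (= polylogarithmic in
the number `N = 2ⁿ` of vertices) star complexity of the slice graphs, hence an `NP` language with
super-polylogarithmic star complexity infinitely often gives `NP ⊄ P/poly`
(`not_NP_subset_PPoly_of_superpoly_starCplx`). Everything here is proved (no named facts).

Also here (**restriction**, Cavalar–Oliveira 2025 Lemma 12 for the inclusion of a sub-grid): the
pool preorder `Below`, `FreeOver.restrict` / `Reach.restrict` / `InterDerivable.restrict`
(`S ↦ S ∩ U` maps constructions to constructions), `freeOver_stars_iff` (the star-free sets are the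
crosses `S × Y ∪ X × T`), `below_restrict_stars` (restricted stars are stars of the sub-grid or
`∅`), and heredity of `IsBipRamsey` under sub-grids.

NOT here: the converse simulation (set constructions → circuits, Cavalar–Oliveira Lemma 12(ii)),
the `AC⁰` analogue (Lemma 1 / §2.6), cover complexity.

## References

* P. Pudlák, V. Rödl, P. Savický, *Graph complexity*, Acta Inform. 25 (1988) 515–535
  [PudlakRodlSavicky1988].
* B. Cavalar, I. Oliveira, *Boolean circuit complexity and two-dimensional cover problems*,
  ACM ToCT 17(2) (2025), arXiv:2503.14117, Lemmas 12–13, Remark 14 [CavalarOliveira2025].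
* S. Jukna, *Boolean Function Complexity* (2012), §1.7.1 [Jukna2012].
-/

namespace Literature.Computability.Complexity.GraphComplexity

open GateList

/-! ### Rails of Boolean-valued functions on a finite ground set -/

section Rails

variable {γ : Type*} [DecidableEq γ]

/-- The `b`-rail of a Boolean-valued function `φ` on the ground set `U`: `{p ∈ U | φ p = b}`. In the
double-rail simulation of a circuit by set operations (Cavalar–Oliveira 2025, proof of Lemma 12 /
Lemma 13; Pudlák–Rödl–Savický 1988) every wire `w` contributes its two rails
`{w = 1}` and `{w = 0}`. [cite: CavalarOliveira2025, Lemma 12] -/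
def rail (U : Finset γ) (φ : γ → Bool) (b : Bool) : Finset γ :=
  U.filter fun p => φ p = b

/-- The rails of a constant function are `U` and `∅`, both free over any pool over which `U` is
free. [folklore] -/
theorem freeOver_rail_const {𝓕 : Set (Finset γ)} {U : Finset γ} (hU : FreeOver 𝓕 U) (c b : Bool) :
    FreeOver 𝓕 (rail U (fun _ => c) b) := by
  by_cases h : c = b
  · subst h
    simpa [rail] using hU
  · simpa [rail, h] using freeOver_empty 𝓕

/-- One intersection step, remembering that the new set is in the pool. [folklore] -/
theorem Reach.snoc_mem {d : ℕ} {𝓖 𝓕 : Set (Finset γ)} {A B : Finset γ} (hR : Reach d 𝓖 𝓕)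
    (hA : FreeOver 𝓕 A) (hB : FreeOver 𝓕 B) :
    ∃ 𝓕' : Set (Finset γ), 𝓕 ⊆ 𝓕' ∧ Reach (d + 1) 𝓖 𝓕' ∧ A ∩ B ∈ 𝓕' :=
  ⟨_, Set.subset_insert _ _, hR.snoc hA hB, Set.mem_insert _ _⟩

/-- Four intersection steps put the four cells `R₀ b₀ ∩ R₁ b₁` of two double rails into the
pool (the fan-in-2 gate step of the double-rail simulation; Cavalar–Oliveira 2025, proof of
Lemma 12, with the constant `4` in place of the monotone-projection count). [cite: CavalarOliveira2025, Lemma 12] -/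
theorem reach_cells {d : ℕ} {𝓖 𝓕 : Set (Finset γ)} (hR : Reach d 𝓖 𝓕) (R₀ R₁ : Bool → Finset γ)
    (h₀ : ∀ b, FreeOver 𝓕 (R₀ b)) (h₁ : ∀ b, FreeOver 𝓕 (R₁ b)) :
    ∃ 𝓕' : Set (Finset γ), 𝓕 ⊆ 𝓕' ∧ Reach (d + 4) 𝓖 𝓕' ∧ ∀ b₀ b₁, R₀ b₀ ∩ R₁ b₁ ∈ 𝓕' := by
  obtain ⟨𝓕₁, s₁, r₁, m₁⟩ := hR.snoc_mem (h₀ false) (h₁ false)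
  obtain ⟨𝓕₂, s₂, r₂, m₂⟩ := r₁.snoc_mem ((h₀ false).mono s₁) ((h₁ true).mono s₁)
  obtain ⟨𝓕₃, s₃, r₃, m₃⟩ := r₂.snoc_mem ((h₀ true).mono (s₁.trans s₂)) ((h₁ false).mono (s₁.trans s₂))
  obtain ⟨𝓕₄, s₄, r₄, m₄⟩ :=
    r₃.snoc_mem ((h₀ true).mono (s₁.trans (s₂.trans s₃))) ((h₁ true).mono (s₁.trans (s₂.trans s₃)))
  refine ⟨𝓕₄, s₁.trans (s₂.trans (s₃.trans s₄)), r₄, ?_⟩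
  rintro (_ | _) (_ | _)
  · exact s₄ (s₃ (s₂ m₁))
  · exact s₄ (s₃ m₂)
  · exact s₄ m₃
  · exact m₄

/-- **Gate step.** If the rails of the (at most two) input wires `w a` of a gate are free over a
pool reached in `d` steps, then after `4` more intersection steps both rails of the gate's output
`p ↦ op (fun a => w a p)` are free: each output rail is a union of cells, and each cell is an
intersection of at most two input rails (Cavalar–Oliveira 2025, Lemmas 12–13: `B₂`-gates cost
`O(1)` intersections; Pudlák–Rödl–Savický 1988, §2). [cite: CavalarOliveira2025, Lemma 13] -/
theorem gate_step {d k : ℕ} (hk : k ≤ 2) {𝓖 𝓕 : Set (Finset γ)} {U : Finset γ}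
    (hR : Reach d 𝓖 𝓕) (hU : FreeOver 𝓕 U) (op : (Fin k → Bool) → Bool) (w : Fin k → γ → Bool)
    (hw : ∀ (a : Fin k) (b : Bool), FreeOver 𝓕 (rail U (w a) b)) :
    ∃ 𝓕' : Set (Finset γ), 𝓕 ⊆ 𝓕' ∧ Reach (d + 4) 𝓖 𝓕' ∧
      ∀ b, FreeOver 𝓕' (rail U (fun p => op fun a => w a p) b) := by
  classical
  -- the cells of the input wires
  set cell : (Fin k → Bool) → Finset γ := fun v => U.filter fun p => (fun a => w a p) = v with hcell
  -- every output rail is a union of cells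
  have hrail : ∀ b, rail U (fun p => op fun a => w a p) b =
      (Finset.univ.filter fun v => op v = b).sup cell := by
    intro b
    ext p
    simp only [rail, Finset.mem_filter, Finset.mem_sup, Finset.mem_univ, true_and, hcell]
    constructor
    · rintro ⟨hp, hb⟩
      exact ⟨fun a => w a p, hb, hp, rfl⟩
    · rintro ⟨v, hb, hp, rfl⟩
      exact ⟨hp, hb⟩
  -- it suffices to free every cell in four steps
  suffices hcells : ∃ 𝓕' : Set (Finset γ), 𝓕 ⊆ 𝓕' ∧ Reach (d + 4) 𝓖 𝓕' ∧ ∀ v, FreeOver 𝓕' (cell v) by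
    obtain ⟨𝓕', hsub, hR', hv⟩ := hcells
    refine ⟨𝓕', hsub, hR', fun b => ?_⟩
    rw [hrail b]
    exact FreeOver.finsetSup _ _ fun v _ => hv v
  match k, hk, op, w, hw, cell, hcell with
  | 0, _, op, w, hw, cell, hcell =>
    -- arity 0: the only cell is `U`
    obtain ⟨𝓕', hsub, hR'⟩ := hR.pad 4
    refine ⟨𝓕', hsub, hR', fun v => ?_⟩
    have : cell v = U := by
      rw [hcell]
      exact Finset.filter_true_of_mem fun p _ => Subsingleton.elim _ _
    rw [this]
    exact hU.mono hsub
  | 1, _, op, w, hw, cell, hcell =>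
    -- arity 1: the cells are the rails of the unique input wire
    obtain ⟨𝓕', hsub, hR'⟩ := hR.pad 4
    refine ⟨𝓕', hsub, hR', fun v => ?_⟩
    have : cell v = rail U (w 0) (v 0) := by
      rw [hcell]
      ext p
      simp only [Finset.mem_filter, rail, funext_iff, Fin.forall_fin_one]
    rw [this]
    exact (hw 0 (v 0)).mono hsub
  | 2, _, op, w, hw, cell, hcell =>
    -- arity 2: the cells are the four intersections of the two double rails
    obtain ⟨𝓕', hsub, hR', hmem⟩ := reach_cells hR (rail U (w 0)) (rail U (w 1)) (hw 0) (hw 1)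
    refine ⟨𝓕', hsub, hR', fun v => ?_⟩
    have : cell v = rail U (w 0) (v 0) ∩ rail U (w 1) (v 1) := by
      rw [hcell]
      ext p
      simp only [Finset.mem_filter, rail, Finset.mem_inter, funext_iff, Fin.forall_fin_two]
      tauto
    rw [this]
    exact FreeOver.of_mem (hmem (v 0) (v 1))
  | k + 3, hk, _, _, _, _, _ => omega

/-- **Double-rail simulation of a straight-line program** (Cavalar–Oliveira 2025, Lemma 13;
Pudlák–Rödl–Savický 1988, §2). Let `pt : γ → {0,1}^ι` attach an input assignment to every point
of the ground set `U`, and suppose `U` and both rails `{p ∈ U | pt p i = b}` of every input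
variable are free over the generators `𝓖`. Then after `4 · |gs|` intersection steps both rails of
every gate value of the `B₂`-program `gs` are free. [cite: CavalarOliveira2025, Lemma 13] -/
theorem exists_reach_rails_vals {ι : Type*} (U : Finset γ) (pt : γ → ι → Bool)
    (𝓖 : Set (Finset γ)) (hU : FreeOver 𝓖 U)
    (hlit : ∀ (i : ι) (b : Bool), FreeOver 𝓖 (rail U (fun p => pt p i) b)) :
    ∀ gs : List (Gate ι), (∀ g ∈ gs, g.fn ∈ B2) →
      ∃ 𝓕 : Set (Finset γ), Reach (4 * gs.length) 𝓖 𝓕 ∧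
        ∀ (m : ℕ) (b : Bool), FreeOver 𝓕 (rail U (fun p => (vals gs (pt p)).getD m false) b) := by
  intro gs
  induction gs using List.reverseRecOn with
  | nil =>
    intro _
    refine ⟨𝓖, (rfl : Reach 0 𝓖 𝓖), fun m b => ?_⟩
    simpa using freeOver_rail_const hU false b
  | append_singleton gs g ih =>
    intro hB
    obtain ⟨𝓕, hR, hrail⟩ := ih fun g' hg' => hB g' (List.mem_append_left _ hg')
    have hk : g.arity ≤ 2 := hB g (List.mem_append_right _ (List.mem_singleton_self g))
    -- the rails of the wires feeding `g` are free over `𝓕`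
    have hw : ∀ (a : Fin g.arity) (b : Bool),
        FreeOver 𝓕 (rail U (fun p => wireOf (pt p) (vals gs (pt p)) (g.args a)) b) := by
      intro a b
      rcases h : g.args a with i | m
      · simpa [h] using (hlit i b).mono hR.subset
      · simpa [h] using hrail m b
    obtain ⟨𝓕', hsub, hR', hnew⟩ :=
      gate_step hk hR (hU.mono hR.subset) g.op (fun a p => wireOf (pt p) (vals gs (pt p)) (g.args a)) hw
    refine ⟨𝓕', by simpa [Nat.mul_succ] using hR', fun m b => ?_⟩
    rcases Nat.lt_trichotomy m gs.length with hm | rfl | hm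
    · -- an old gate: same rail as before
      have : (fun p => (vals (gs ++ [g]) (pt p)).getD m false) =
          fun p => (vals gs (pt p)).getD m false := by
        funext p
        rw [vals_append_singleton, List.getD_append _ _ _ _ (by simpa using hm)]
      rw [this]
      exact (hrail m b).mono hsub
    · -- the new gate
      have : (fun p => (vals (gs ++ [g]) (pt p)).getD gs.length false) =
          fun p => g.op fun a => wireOf (pt p) (vals gs (pt p)) (g.args a) := by
        funext p
        rw [vals_append_singleton, List.getD_append_right _ _ _ _ (by simp)]
        simp
      rw [this]
      exact hnew b
    · -- out of range: the constant `false`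
      have : (fun p => (vals (gs ++ [g]) (pt p)).getD m false) = fun _ => false := by
        funext p
        rw [List.getD_eq_default]
        simp only [List.length_append, length_vals, List.length_singleton]
        omega
      rw [this]
      exact freeOver_rail_const (hU.mono (hR.subset.trans hsub)) false b

/-- **Transference, circuits → intersection complexity** (Cavalar–Oliveira 2025, Lemma 13 with
Remark 14; Pudlák–Rödl–Savický 1988): under the hypotheses of `exists_reach_rails_vals`, the set
of points of `U` accepted by a `B₂`-circuit `C` is derivable from `𝓖` with at most `4 · size C`
intersections. [cite: CavalarOliveira2025, Lemma 13] -/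
theorem interDerivable_filter_eval {ι : Type*} (U : Finset γ) (pt : γ → ι → Bool)
    (𝓖 : Set (Finset γ)) (hU : FreeOver 𝓖 U)
    (hlit : ∀ (i : ι) (b : Bool), FreeOver 𝓖 (rail U (fun p => pt p i) b))
    (C : Circuit ι) (hC : C.IsOver B2) :
    InterDerivable 𝓖 (4 * C.size) (U.filter fun p => C.eval (pt p) = true) := by
  obtain ⟨𝓕, hR, hrail⟩ := exists_reach_rails_vals U pt 𝓖 hU hlit C.gates hC
  refine ⟨𝓕, hR, ?_⟩
  have heval : ∀ x, C.eval x = wireOf x (vals C.gates x) C.output := by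
    intro x
    unfold Circuit.eval
    cases C.output <;> rfl
  rcases h : C.output with i | m
  · simpa [rail, heval, h] using (hlit i true).mono hR.subset
  · simpa [rail, heval, h] using hrail m true

end Rails

/-! ### The bipartite slice graphs of a language -/

section Slice

variable {n : ℕ}

/-- The whole grid `{0,1}ⁿ × {0,1}ⁿ` is the union of its row stars. [folklore] -/
theorem freeOver_stars_univ :
    FreeOver (stars (Finset.univ : Finset (Fin n → Bool)) (Finset.univ : Finset (Fin n → Bool)))
      Finset.univ := by
  have h : (Finset.univ : Finset (Fin n → Bool)).sup (rowStar (Finset.univ : Finset (Fin n → Bool))) =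
      Finset.univ := by
    ext ⟨x, y⟩
    simp [Finset.mem_sup, rowStar]
  rw [← h]
  exact FreeOver.finsetSup _ _ fun x _ => FreeOver.of_mem (rowStar_mem_stars _ (Finset.mem_univ x))

/-- The rails of an input variable of `f_G(x, y)` are unions of stars: a left variable `x_j = b`
is the union of the row stars `R_x` over `x` with `x_j = b`, a right variable the union of column
stars (Cavalar–Oliveira 2025, proof of Lemma 13: "each input literal is either in `𝓡_N` or in
`𝓒_N`"). [cite: CavalarOliveira2025, Lemma 13] -/
theorem freeOver_stars_rail_append (i : Fin (n + n)) (b : Bool) :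
    FreeOver (stars (Finset.univ : Finset (Fin n → Bool)) (Finset.univ : Finset (Fin n → Bool)))
      (rail Finset.univ (fun p : (Fin n → Bool) × (Fin n → Bool) => Fin.append p.1 p.2 i) b) := by
  induction i using Fin.addCases with
  | left j =>
    have h : rail Finset.univ (fun p : (Fin n → Bool) × (Fin n → Bool) => Fin.append p.1 p.2
        (Fin.castAdd n j)) b = (Finset.univ.filter fun x : Fin n → Bool => x j = b).sup
          (rowStar Finset.univ) := by
      ext ⟨x, y⟩
      simp only [Fin.append_left]
      simp [rail, Finset.mem_sup, rowStar]
    rw [h]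
    exact FreeOver.finsetSup _ _ fun x _ => FreeOver.of_mem (rowStar_mem_stars _ (Finset.mem_univ x))
  | right j =>
    have h : rail Finset.univ (fun p : (Fin n → Bool) × (Fin n → Bool) => Fin.append p.1 p.2
        (Fin.natAdd n j)) b = (Finset.univ.filter fun y : Fin n → Bool => y j = b).sup
          (colStar Finset.univ) := by
      ext ⟨x, y⟩
      simp only [Fin.append_right]
      simp [rail, Finset.mem_sup, colStar]
    rw [h]
    exact FreeOver.finsetSup _ _ fun y _ => FreeOver.of_mem (colStar_mem_stars _ (Finset.mem_univ y))

/-- **Transference for slice graphs** (Cavalar–Oliveira 2025, Lemma 13 and Remark 14;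
Pudlák–Rödl–Savický 1988): a `B₂`-circuit of size `s` for the `2n`-th slice of `L` yields a
star-derivation of the bipartite graph `bipSlice L n` with at most `4 s` intersections. (The
encoding `[N] ≃ {0,1}ⁿ` of Lemma 13 is the identity here: the vertices ARE bit-vectors.) [cite: CavalarOliveira2025, Lemma 13] -/
theorem starCplx_bipSlice_le_size (L : Language Bool) (C : Circuit (Fin (n + n))) (hC : C.IsOver B2)
    (hL : C.Computes (L.sliceFn (n + n))) :
    starCplx Finset.univ Finset.univ (bipSlice L n) ≤ 4 * C.size := by
  classical
  have h := interDerivable_filter_eval (Finset.univ : Finset ((Fin n → Bool) × (Fin n → Bool)))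
    (fun p => Fin.append p.1 p.2) (stars Finset.univ Finset.univ) freeOver_stars_univ
    freeOver_stars_rail_append C hC
  have hG : (Finset.univ.filter fun p : (Fin n → Bool) × (Fin n → Bool) =>
      C.eval (Fin.append p.1 p.2) = true) = bipSlice L n := by
    ext p
    rw [mem_bipSlice, Finset.mem_filter, hL, Language.sliceFn, List.ofFn_fin_append,
      ← Set.mem_iff_boolIndicator]
    simp only [Finset.mem_univ, true_and]
    exact Iff.rfl
  rw [hG] at h
  exact interCplx_le_of_interDerivable h

/-- `D_∩(bipSlice L n ∣ 𝒢) ≤ 4 · (circuit complexity of L at length 2n)`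
(Cavalar–Oliveira 2025, Lemma 13 / Remark 14). [cite: CavalarOliveira2025, Lemma 13] -/
theorem starCplx_bipSlice_le_circuitSize (L : Language Bool) (n : ℕ) :
    starCplx Finset.univ Finset.univ (bipSlice L n) ≤ 4 * L.circuitSize (n + n) := by
  obtain ⟨C, hC, hL, hs⟩ := exists_circuit_size_eq_circuitSize L (n + n)
  rw [← hs]
  exact starCplx_bipSlice_le_size L C hC hL

/-- Polynomials are eventually dominated by a power: `4 · p(2n) ≤ n^(deg p + 1)` for all large
`n`. [folklore] -/
theorem eventually_four_mul_eval_two_mul_le_pow (p : Polynomial ℕ) :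
    ∀ᶠ n in Filter.atTop, 4 * p.eval (n + n) ≤ n ^ (p.natDegree + 1) := by
  have key : ∀ m : ℕ, 1 ≤ m → p.eval m ≤ p.eval 1 * m ^ p.natDegree := by
    intro m hm
    rw [Polynomial.eval_eq_sum_range, Polynomial.eval_eq_sum_range, Finset.sum_mul]
    refine Finset.sum_le_sum fun i hi => ?_
    rw [one_pow, mul_one]
    exact Nat.mul_le_mul_left _
      (Nat.pow_le_pow_right hm (Nat.lt_succ_iff.mp (Finset.mem_range.mp hi)))
  refine Filter.eventually_atTop.2 ⟨4 * p.eval 1 * 2 ^ p.natDegree + 1, fun n hn => ?_⟩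
  have hn1 : 1 ≤ n := le_trans (Nat.succ_le_succ (Nat.zero_le _)) hn
  calc 4 * p.eval (n + n) ≤ 4 * (p.eval 1 * (n + n) ^ p.natDegree) :=
        Nat.mul_le_mul_left _ (key _ (by omega))
    _ = (4 * p.eval 1 * 2 ^ p.natDegree) * n ^ p.natDegree := by
        rw [← two_mul, mul_pow]; ring
    _ ≤ n * n ^ p.natDegree := Nat.mul_le_mul_right _ (by omega)
    _ = n ^ (p.natDegree + 1) := by ring

/-- A language with polynomial-size circuits has slice graphs of polynomial star complexity
(Cavalar–Oliveira 2025, Lemma 13: `D_∩(G ∣ 𝒢_{N,N}) = O(size)`). [cite: CavalarOliveira2025, Lemma 13] -/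
theorem exists_eventually_starCplx_le_pow_of_mem_PPoly {L : Language Bool} (h : L ∈ PPoly) :
    ∃ c : ℕ, ∀ᶠ n in Filter.atTop, starCplx Finset.univ Finset.univ (bipSlice L n) ≤ n ^ c := by
  obtain ⟨p, hp⟩ : ∃ p : Polynomial ℕ, L ∈ SIZE fun n => p.eval n := by
    simpa [PPoly] using h
  refine ⟨p.natDegree + 1, (eventually_four_mul_eval_two_mul_le_pow p).mono fun n hn => ?_⟩
  have hsz := (mem_SIZE_iff_circuitSize_le_holds L _).1 hp (n + n)
  exact (starCplx_bipSlice_le_circuitSize L n).trans ((Nat.mul_le_mul_left 4 hsz).trans hn)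

/-- **Magnification lemma of graph complexity** (Pudlák–Rödl–Savický 1988, §1; Jukna 2012,
§1.7.1; Cavalar–Oliveira 2025, §1.2 and Lemma 13): an `NP` language whose slice graphs have
super-polynomial — i.e. super-polylogarithmic in the number of vertices `N = 2ⁿ` — star complexity
infinitely often separates `NP` from `P/poly`. [cite: CavalarOliveira2025, §1.2] -/
theorem not_NP_subset_PPoly_of_superpoly_starCplx
    (h : ∃ L ∈ Nondeterministic.NP, ∀ c : ℕ, ∃ᶠ n in Filter.atTop,
      n ^ c < starCplx Finset.univ Finset.univ (bipSlice L n)) :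
    ¬ (Nondeterministic.NP ⊆ PPoly) := by
  intro hsub
  obtain ⟨L, hL, hlow⟩ := h
  obtain ⟨c, hc⟩ := exists_eventually_starCplx_le_pow_of_mem_PPoly (hsub hL)
  exact ((hlow c).and_eventually hc).exists.elim fun n hn => absurd hn.2 (not_le.2 hn.1)

end Slice

end Literature.Computability.Complexity.GraphComplexity


/-! ## Restriction to a sub-grid (Cavalar–Oliveira 2025, Lemma 12 for the inclusion map) and the
structure of star-free sets

`CavalarOliveira2025` Lemma 12 (transference under an injective `φ : Γ₁ → Γ₂`): pulling a
construction back along `φ` costs only the complexity of the pulled-back generators. For the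
inclusion of a sub-grid `X' × Y' ⊆ X × Y` every star pulls back to a star of the sub-grid or to `∅`
(free, Fact 8), so `D_∩` does not increase under restriction (`InterDerivable.restrict` +
`below_restrict_stars`). `freeOver_stars_iff`: the sets free over the stars of `X × Y` are exactly
the crosses `S × Y ∪ X × T`. -/

namespace Literature.Computability.Complexity.GraphComplexity

section Below

variable {γ : Type*} [DecidableEq γ]

/-- Pool preorder: every member of `𝓟` is a union of members of `𝓠` (the cost-free case of
Cavalar–Oliveira's transference). [cite: CavalarOliveira2025, Lemma 12] -/
def Below (𝓟 𝓠 : Set (Finset γ)) : Prop := ∀ P ∈ 𝓟, FreeOver 𝓠 P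

/-- Freeness is transitive along the pool preorder. [cite: CavalarOliveira2025, Lemma 12] -/
theorem Below.freeOver {𝓟 𝓠 : Set (Finset γ)} (h : Below 𝓟 𝓠) {A : Finset γ} (hA : FreeOver 𝓟 A) :
    FreeOver 𝓠 A :=
  hA.trans h

/-- Adding the same set to both pools preserves the preorder. [folklore] -/
theorem Below.insert {𝓟 𝓠 : Set (Finset γ)} (h : Below 𝓟 𝓠) (A : Finset γ) :
    Below (insert A 𝓟) (insert A 𝓠) := by
  rintro P (rfl | hP)
  · exact FreeOver.of_mem (Set.mem_insert _ _)
  · exact (h P hP).mono (Set.subset_insert _ _)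

/-- A construction from `𝓟` can be replayed from any pool above `𝓟`.
[cite: CavalarOliveira2025, Lemma 12] -/
theorem Reach.below : ∀ {d : ℕ} {𝓟 𝓠 𝓕 : Set (Finset γ)}, Reach d 𝓟 𝓕 → Below 𝓟 𝓠 →
    ∃ 𝓕' : Set (Finset γ), Reach d 𝓠 𝓕' ∧ Below 𝓕 𝓕'
  | 0, _, _, _, h, hb => by subst h; exact ⟨_, rfl, hb⟩
  | _ + 1, _, _, _, ⟨A, B, hA, hB, h⟩, hb => by
    obtain ⟨𝓕', h', hb'⟩ := Reach.below h (hb.insert (A ∩ B))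
    exact ⟨𝓕', ⟨A, B, hb.freeOver hA, hb.freeOver hB, h'⟩, hb'⟩

/-- `D_∩` is monotone along the pool preorder (transference with free pulled-back generators).
[cite: CavalarOliveira2025, Lemma 12] -/
theorem InterDerivable.below {𝓟 𝓠 : Set (Finset γ)} {d : ℕ} {A : Finset γ} (h : InterDerivable 𝓟 d A)
    (hb : Below 𝓟 𝓠) : InterDerivable 𝓠 d A := by
  obtain ⟨𝓕, hR, hA⟩ := h
  obtain ⟨𝓕', hR', hb'⟩ := hR.below hb
  exact ⟨𝓕', hR', hb'.freeOver hA⟩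

/-- A generator that is already free over the others is redundant. [cite: CavalarOliveira2025, Lemma 12] -/
theorem InterDerivable.of_insert_free {𝓖 : Set (Finset γ)} {C A : Finset γ} {d : ℕ}
    (h : InterDerivable (insert C 𝓖) d A) (hC : FreeOver 𝓖 C) : InterDerivable 𝓖 d A :=
  h.below (by
    rintro P (rfl | hP)
    exacts [hC, FreeOver.of_mem hP])

/-- Restriction to a sub-ground-set `U` (every set `S ↦ S ∩ U`, the pull-back along the inclusion
`U ↪ Γ`) preserves freeness. [cite: CavalarOliveira2025, Lemma 12] -/
theorem FreeOver.restrict (U : Finset γ) {𝓟 : Set (Finset γ)} {A : Finset γ} (hA : FreeOver 𝓟 A) :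
    FreeOver ((· ∩ U) '' 𝓟) (A ∩ U) := by
  obtain ⟨𝒪, h𝒪, rfl⟩ := hA
  refine ⟨𝒪.image (· ∩ U), ?_, ?_⟩
  · rw [Finset.coe_image]
    exact Set.image_mono h𝒪
  · rw [Finset.sup_image]
    change _ = 𝒪.sup id ⊓ U
    rw [Finset.sup_inf_distrib_right]
    rfl

/-- Restriction preserves derivations step by step (`(A ∩ B) ∩ U = (A ∩ U) ∩ (B ∩ U)`).
[cite: CavalarOliveira2025, Lemma 12] -/
theorem Reach.restrict (U : Finset γ) : ∀ {d : ℕ} {𝓖 𝓕 : Set (Finset γ)}, Reach d 𝓖 𝓕 →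
    Reach d ((· ∩ U) '' 𝓖) ((· ∩ U) '' 𝓕)
  | 0, _, _, h => by subst h; rfl
  | _ + 1, _, _, ⟨A, B, hA, hB, h⟩ => by
    refine ⟨A ∩ U, B ∩ U, hA.restrict U, hB.restrict U, ?_⟩
    have h' := Reach.restrict U h
    rwa [Set.image_insert_eq, Finset.inter_inter_distrib_right] at h'

/-- `D_∩(A ∩ U ∣ 𝓖|ᵤ) ≤ D_∩(A ∣ 𝓖)`: transference along the inclusion of `U`.
[cite: CavalarOliveira2025, Lemma 12] -/
theorem InterDerivable.restrict (U : Finset γ) {𝓖 : Set (Finset γ)} {d : ℕ} {A : Finset γ}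
    (h : InterDerivable 𝓖 d A) : InterDerivable ((· ∩ U) '' 𝓖) d (A ∩ U) := by
  obtain ⟨𝓕, hR, hA⟩ := h
  exact ⟨_, hR.restrict U, hA.restrict U⟩

end Below

section RamseyStars

variable {α β : Type*} [DecidableEq α] [DecidableEq β]

/-- The sets free over the stars of `X × Y` are exactly the crosses `S × Y ∪ X × T`. [folklore] -/
theorem freeOver_stars_iff {X : Finset α} {Y : Finset β} {A : Finset (α × β)} :
    FreeOver (stars X Y) A ↔ ∃ S ⊆ X, ∃ T ⊆ Y, A = S ×ˢ Y ∪ X ×ˢ T := by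
  classical
  constructor
  · rintro ⟨𝒪, h𝒪, rfl⟩
    refine ⟨X.filter fun x => rowStar Y x ∈ 𝒪, Finset.filter_subset _ _,
      Y.filter fun y => colStar X y ∈ 𝒪, Finset.filter_subset _ _, ?_⟩
    ext ⟨a, b⟩
    simp only [Finset.mem_sup, id, Finset.mem_union, Finset.mem_product, Finset.mem_filter]
    constructor
    · rintro ⟨O, hO, hab⟩
      rcases h𝒪 hO with ⟨x, hx, rfl⟩ | ⟨y, hy, rfl⟩
      · simp only [rowStar, Finset.mem_product, Finset.mem_singleton] at hab
        obtain ⟨rfl, hb⟩ := hab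
        exact Or.inl ⟨⟨hx, hO⟩, hb⟩
      · simp only [colStar, Finset.mem_product, Finset.mem_singleton] at hab
        obtain ⟨ha, rfl⟩ := hab
        exact Or.inr ⟨ha, hy, hO⟩
    · rintro (⟨⟨ha, hO⟩, hb⟩ | ⟨ha, hb, hO⟩)
      · exact ⟨_, hO, by simp [rowStar, hb]⟩
      · exact ⟨_, hO, by simp [colStar, ha]⟩
  · rintro ⟨S, hS, T, hT, rfl⟩
    have h1 : S ×ˢ Y = S.sup (rowStar Y) := by
      ext ⟨a, b⟩
      simp [Finset.mem_sup, rowStar]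
    have h2 : X ×ˢ T = T.sup (colStar X) := by
      ext ⟨a, b⟩
      simp only [Finset.mem_product, Finset.mem_sup, colStar, Finset.mem_singleton]
      constructor
      · rintro ⟨ha, hb⟩
        exact ⟨b, hb, ha, rfl⟩
      · rintro ⟨y, hy, ha, rfl⟩
        exact ⟨ha, hy⟩
    rw [h1, h2]
    exact (FreeOver.finsetSup _ _ fun x hx => FreeOver.of_mem (rowStar_mem_stars Y (hS hx))).union
      (FreeOver.finsetSup _ _ fun y hy => FreeOver.of_mem (colStar_mem_stars X (hT hy)))

/-- The stars of `X × Y`, restricted to a sub-grid `X' × Y'`, are stars of the sub-grid or empty,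
so the pulled-back generators are free. [cite: CavalarOliveira2025, Lemma 12] -/
theorem below_restrict_stars {X X' : Finset α} {Y Y' : Finset β} (hX : X' ⊆ X) (hY : Y' ⊆ Y) :
    Below ((· ∩ X' ×ˢ Y') '' stars X Y) (stars X' Y') := by
  rintro _ ⟨P, hP, rfl⟩
  dsimp only
  rcases hP with ⟨x, hx, rfl⟩ | ⟨y, hy, rfl⟩
  · by_cases hx' : x ∈ X'
    · have : rowStar Y x ∩ X' ×ˢ Y' = rowStar Y' x := by
        ext ⟨a, b⟩
        simp only [rowStar, Finset.mem_inter, Finset.mem_product, Finset.mem_singleton]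
        constructor
        · rintro ⟨⟨rfl, -⟩, -, hb⟩
          exact ⟨rfl, hb⟩
        · rintro ⟨rfl, hb⟩
          exact ⟨⟨rfl, hY hb⟩, hx', hb⟩
      rw [this]
      exact FreeOver.of_mem (rowStar_mem_stars Y' hx')
    · have : rowStar Y x ∩ X' ×ˢ Y' = ∅ := by
        ext ⟨a, b⟩
        simp only [rowStar, Finset.mem_inter, Finset.mem_product, Finset.mem_singleton,
          Finset.notMem_empty, iff_false, not_and, and_imp]
        rintro rfl - ha -
        exact hx' ha
      rw [this]
      exact freeOver_empty _
  · by_cases hy' : y ∈ Y'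
    · have : colStar X y ∩ X' ×ˢ Y' = colStar X' y := by
        ext ⟨a, b⟩
        simp only [colStar, Finset.mem_inter, Finset.mem_product, Finset.mem_singleton]
        constructor
        · rintro ⟨⟨-, rfl⟩, ha, -⟩
          exact ⟨ha, rfl⟩
        · rintro ⟨ha, rfl⟩
          exact ⟨⟨hX ha, rfl⟩, ha, hy'⟩
      rw [this]
      exact FreeOver.of_mem (colStar_mem_stars X' hy')
    · have : colStar X y ∩ X' ×ˢ Y' = ∅ := by
        ext ⟨a, b⟩
        simp only [colStar, Finset.mem_inter, Finset.mem_product, Finset.mem_singleton,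
          Finset.notMem_empty, iff_false, not_and, and_imp]
        rintro - rfl - hb
        exact hy' hb
      rw [this]
      exact freeOver_empty _

/-- Ramsey-ness is hereditary under passing to a sub-grid. [folklore] -/
theorem IsBipRamsey.restrict {X X' : Finset α} {Y Y' : Finset β} {K : ℕ} {G : Finset (α × β)}
    (h : IsBipRamsey X Y K G) (hX : X' ⊆ X) (hY : Y' ⊆ Y) :
    IsBipRamsey X' Y' K (G ∩ X' ×ˢ Y') := by
  intro S hS T hT hSc hTc
  have hST : S ×ˢ T ⊆ X' ×ˢ Y' := Finset.product_subset_product hS hT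
  obtain ⟨h1, h2⟩ := h (hS.trans hX) (hT.trans hY) hSc hTc
  refine ⟨fun hsub => h1 (hsub.trans Finset.inter_subset_left), fun hdis => h2 ?_⟩
  rw [Finset.disjoint_left] at hdis ⊢
  intro p hp hpG
  exact hdis hp (Finset.mem_inter.2 ⟨hpG, hST hp⟩)

omit [DecidableEq α] [DecidableEq β] in
/-- No graph is `0`-Ramsey. [folklore] -/
theorem not_isBipRamsey_zero {X : Finset α} {Y : Finset β} {G : Finset (α × β)} :
    ¬ IsBipRamsey X Y 0 G := fun h =>
  (h (Finset.empty_subset X) (Finset.empty_subset Y) rfl rfl).1 (by simp)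


end RamseyStars

end Literature.Computability.Complexity.GraphComplexity
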